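import Mathlib
import HarnessLib

/-!
# Torsion in `ℤ/N` versus the supply of products of small primes

Literature / complexity toolkit (number theory for the deterministic factoring machine after
Harvey 2021, arXiv:2010.05450).  The machine replaces Strassen's small-factor test (Prop. 6)
and Hittmeir's large-order element (Prop. 8) by a search over the bases `a = 2, 3, 4, …, B`:
each base either yields a factor / a certificate, or is found to have multiplicative order
dividing a known `L`.  That the search cannot exhaust all bases `≤ B` without success, for `N`
large, is the following counting argument, proved here in full:

* `powOneCount N L = #{x ∈ ℤ/N : x^L = 1}` and **`powOneCount_le`**: for `N` odd and `L ≥ 1`,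
  `powOneCount N L ≤ L^{ω(N)}` (`ω(N) = #N.primeFactors`) — by the Chinese remainder theorem
  (`ZMod.chineseRemainder`, `powOneCount_le_of_ringEquiv`) down to odd prime powers, whose unit
  groups are cyclic (`ZMod.isCyclic_units_of_prime_pow`, `IsCyclic.card_pow_eq_one_le`;
  `powOneCount_primePow_le`);
* **`exists_many_products`** / **`le_card_pow_eq_one`**: if `u · m ≤ π(B)` there are `m^u`
  distinct positive integers `≤ B^u`, each a product of `u` integers from `[2, B]` (one prime
  from each of `u` disjoint blocks of `m` consecutive primes: `blockProd`, injective by unique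
  factorisation, `blockProd_injective`); hence if every `a ∈ [2, B]` has `a^L = 1` in `ℤ/N` and
  `B^u < N`, then `m^u ≤ #{x : x^L = 1}`.

Together: `m^u ≤ L^{ω(N)}`; with `B = 2^{⌈√n⌉}` and Chebyshev's bound for `π(B)`
(`CRRFacts.two_pow_le_mul_primeCounting`) the left side is `2^{n − O(√n log n)}`, which beats
`L^{ω(N)} ≤ N^{4/5 + o(1)}` — the quantitative form is assembled with the machine.

## References

* D. Harvey, *An exponent one-fifth algorithm for deterministic integer factorisation*,
  Math. Comp. 90 (2021) 2937–2950, §2.3–2.4 (the roles of Props. 2.5, 2.7). [Harvey2021]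
* M. Hittmeir, *A babystep-giantstep method for faster deterministic integer factorization*,
  Math. Comp. 87 (2018) 2915–2935 (orders of small bases reveal the residues of the prime
  factors). (Elementary material, fully proved here.)
-/

namespace Literature.Computability.Complexity

namespace HarveyNT

open Finset

/-- The solutions of `x^L = 1` in `ℤ/N`. [folklore] -/
noncomputable def powOneCount (N L : ℕ) [NeZero N] : ℕ := (univ.filter fun x : ZMod N => x ^ L = 1).card

/-- In `ℤ/p^n` (`p` an odd prime) there are at most `L` solutions of `x^L = 1` (`L ≥ 1`): the unit
group is cyclic. [folklore] -/
theorem powOneCount_primePow_le {p n L : ℕ} (hp : p.Prime) (hp2 : p ≠ 2) (hL : 0 < L) :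
    haveI : NeZero (p ^ n) := ⟨pow_ne_zero _ hp.ne_zero⟩
    powOneCount (p ^ n) L ≤ L := by
  haveI : NeZero (p ^ n) := ⟨pow_ne_zero _ hp.ne_zero⟩
  haveI : IsCyclic (ZMod (p ^ n))ˣ := ZMod.isCyclic_units_of_prime_pow p hp hp2 n
  classical
  unfold powOneCount
  -- solutions are units; inject into the `L`-torsion of the unit group
  have hinj : (univ.filter fun x : ZMod (p ^ n) => x ^ L = 1).card ≤ (univ.filter fun u : (ZMod (p ^ n))ˣ => u ^ L = 1).card := by
    refine card_le_card_of_injOn (fun x => if h : IsUnit x then h.unit else 1) (fun x hx => ?_) (fun x hx y hy hxy => ?_)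
    · rw [mem_coe, mem_filter] at hx
      have hu : IsUnit x := IsUnit.of_pow_eq_one hx.2 hL.ne'
      simp only [dif_pos hu, coe_filter, Set.mem_setOf_eq, mem_univ, true_and]
      ext; simp [hx.2]
    · rw [mem_coe, mem_filter] at hx hy
      have hu : IsUnit x := IsUnit.of_pow_eq_one hx.2 hL.ne'
      have hv : IsUnit y := IsUnit.of_pow_eq_one hy.2 hL.ne'
      simp only [dif_pos hu, dif_pos hv] at hxy
      have := congrArg (fun u : (ZMod (p ^ n))ˣ => (u : ZMod (p ^ n))) hxy
      simpa using this
  exact hinj.trans (IsCyclic.card_pow_eq_one_le hL)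

/-- `powOneCount` transported along a ring isomorphism. [folklore] -/
theorem powOneCount_le_of_ringEquiv {A B : ℕ} [NeZero A] [NeZero B] {C : ℕ} [NeZero C] (L : ℕ)
    (e : ZMod A ≃+* ZMod B × ZMod C) : powOneCount A L ≤ powOneCount B L * powOneCount C L := by
  classical
  unfold powOneCount
  rw [← card_product]
  refine card_le_card_of_injOn e (fun x hx => ?_) (fun x _ y _ hxy => e.injective hxy)
  rw [mem_coe, mem_filter] at hx
  have h := congrArg e hx.2
  rw [map_pow, map_one] at h
  simp only [coe_product, coe_filter, Set.mem_prod, Set.mem_setOf_eq, mem_univ, true_and]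
  exact ⟨by simpa using congrArg Prod.fst h, by simpa using congrArg Prod.snd h⟩

/-- **At most `L^{ω(N)}` solutions of `x^L = 1` modulo an odd `N`** (`L ≥ 1`). [folklore] -/
theorem powOneCount_le (L : ℕ) (hL : 0 < L) : ∀ (N : ℕ) [NeZero N], Odd N → powOneCount N L ≤ L ^ N.primeFactors.card := by
  intro N
  induction N using Nat.recOnPosPrimePosCoprime with
  | prime_pow p n hp hn =>
    intro _ hodd
    have hp2 : p ≠ 2 := by
      rintro rfl; exact (Nat.not_even_iff_odd.2 hodd) (even_iff_two_dvd.2 (dvd_pow_self 2 hn.ne'))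
    rw [Nat.primeFactors_prime_pow hn.ne' hp, card_singleton, pow_one]
    exact powOneCount_primePow_le hp hp2 hL
  | zero => intro h _; exact absurd rfl h.out
  | one =>
    intro _ _
    unfold powOneCount
    rw [Nat.primeFactors_one, card_empty, pow_zero]
    exact (card_le_univ _).trans (by simp)
  | coprime a b ha hb hab iha ihb =>
    intro _ hodd
    haveI : NeZero a := ⟨by omega⟩
    haveI : NeZero b := ⟨by omega⟩
    have hoa : Odd a := Nat.Odd.of_mul_left hodd
    have hob : Odd b := Nat.Odd.of_mul_right hodd
    have e : ZMod (a * b) ≃+* ZMod a × ZMod b := ZMod.chineseRemainder hab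
    refine (powOneCount_le_of_ringEquiv L e).trans ?_
    rw [Nat.Coprime.primeFactors_mul hab, card_union_of_disjoint (Nat.Coprime.disjoint_primeFactors hab), pow_add]
    exact Nat.mul_le_mul (iha hoa) (ihb hob)


/-- The `i`-th prime (from `p_0 = 2`). [folklore] -/
noncomputable def nthPrime (i : ℕ) : ℕ := Nat.nth Nat.Prime i

/-- `nthPrime i` is prime. [folklore] -/
theorem prime_nthPrime (i : ℕ) : (nthPrime i).Prime := Nat.prime_nth_prime i

/-- The primes of index `< π(B)` are `≤ B`. [folklore] -/
theorem nthPrime_le {i B : ℕ} (hi : i < Nat.primeCounting B) : nthPrime i ≤ B := by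
  have h : Nat.nth Nat.Prime i < B + 1 := Nat.nth_lt_of_lt_count (by simpa [Nat.primeCounting, Nat.primeCounting'] using hi)
  unfold nthPrime; omega

/-- `nthPrime` is injective. [folklore] -/
theorem nthPrime_injective : Function.Injective nthPrime := Nat.nth_injective Nat.infinite_setOf_prime

/-- The product attached to a choice function `g : Fin u → Fin m`: one prime from each of `u`
disjoint blocks of `m` consecutive primes. [folklore] -/
noncomputable def blockProd (m : ℕ) {u : ℕ} (g : Fin u → Fin m) : ℕ := ∏ i : Fin u, nthPrime (i * m + g i)

/-- The block products are products of `u` integers in `[2, B]` when `u · m ≤ π(B)`. [folklore] -/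
theorem blockProd_factors {B u m : ℕ} (h : u * m ≤ Nat.primeCounting B) (g : Fin u → Fin m) :
    ∃ l : List ℕ, l.length = u ∧ (∀ a ∈ l, 2 ≤ a ∧ a ≤ B) ∧ l.prod = blockProd m g := by
  refine ⟨(List.ofFn fun i : Fin u => nthPrime (i * m + g i)), by simp, fun a ha => ?_, ?_⟩
  · rw [List.mem_ofFn] at ha
    obtain ⟨i, rfl⟩ := ha
    refine ⟨(prime_nthPrime _).two_le, nthPrime_le (lt_of_lt_of_le ?_ h)⟩
    have hi := i.isLt; have hg := (g i).isLt
    calc (i : ℕ) * m + g i < i * m + m := by omega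
      _ = (i + 1) * m := by ring
      _ ≤ u * m := Nat.mul_le_mul_right _ hi
  · rw [blockProd, List.prod_ofFn]

/-- The block products are at most `B^u`. [folklore] -/
theorem blockProd_le {B u m : ℕ} (h : u * m ≤ Nat.primeCounting B) (g : Fin u → Fin m) : blockProd m g ≤ B ^ u := by
  obtain ⟨l, hl, hlB, hprod⟩ := blockProd_factors h g
  rw [← hprod, ← hl]
  exact List.prod_le_pow_card l B fun a ha => (hlB a ha).2

/-- The block products are positive. [folklore] -/
theorem blockProd_pos (m : ℕ) {u : ℕ} (g : Fin u → Fin m) : 0 < blockProd m g :=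
  prod_pos fun _ _ => (prime_nthPrime _).pos

/-- **Distinct choices give distinct products** (unique factorisation). [folklore] -/
theorem blockProd_injective (m u : ℕ) : Function.Injective (blockProd m (u := u)) := by
  intro g g' hgg
  funext i
  have hdvd : nthPrime (i * m + g i) ∣ blockProd m g' := by
    rw [← hgg, blockProd]; exact dvd_prod_of_mem _ (mem_univ i)
  rw [blockProd, (prime_nthPrime _).prime.dvd_finsetProd_iff] at hdvd
  obtain ⟨j, -, hj⟩ := hdvd
  have heq : nthPrime (i * m + g i) = nthPrime (j * m + g' j) :=
    (Nat.prime_dvd_prime_iff_eq (prime_nthPrime _) (prime_nthPrime _)).1 hj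
  have hidx := nthPrime_injective heq
  have hgi := (g i).isLt; have hgj := (g' j).isLt
  have hij : (i : ℕ) = j := by
    have h1 : (i : ℕ) * m + g i < (i + 1) * m := by nlinarith
    have h2 : (j : ℕ) * m + g' j < (j + 1) * m := by nlinarith
    have h3 : (i : ℕ) * m ≤ j * m + g' j := by omega
    have h4 : (j : ℕ) * m ≤ i * m + g i := by omega
    by_contra hne
    rcases Nat.lt_or_gt_of_ne hne with hlt | hlt
    · have : ((i : ℕ) + 1) * m ≤ j * m := Nat.mul_le_mul_right _ hlt
      omega
    · have : ((j : ℕ) + 1) * m ≤ i * m := Nat.mul_le_mul_right _ hlt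
      omega
  have hj' : j = i := Fin.ext hij.symm
  subst hj'
  exact Fin.ext (by omega)

/-- **The smooth-number supply.** If `u · m ≤ π(B)` there are `m^u` distinct positive integers
`≤ B^u`, each a product of `u` integers from `[2, B]`. [folklore] -/
theorem exists_many_products {B u m : ℕ} (h : u * m ≤ Nat.primeCounting B) :
    ∃ S : Finset ℕ, S.card = m ^ u ∧ ∀ s ∈ S, 0 < s ∧ s ≤ B ^ u ∧
      ∃ l : List ℕ, l.length = u ∧ (∀ a ∈ l, 2 ≤ a ∧ a ≤ B) ∧ l.prod = s := by
  classical
  refine ⟨univ.image (blockProd m (u := u)), ?_, fun s hs => ?_⟩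
  · rw [card_image_of_injective _ (blockProd_injective m u), card_univ, Fintype.card_fun, Fintype.card_fin, Fintype.card_fin]
  · rw [mem_image] at hs
    obtain ⟨g, -, rfl⟩ := hs
    exact ⟨blockProd_pos m g, blockProd_le h g, blockProd_factors h g⟩

/-- A product of bases with `a^L = 1` has `L`-th power `1`. [folklore] -/
theorem cast_prod_pow_eq_one {N L : ℕ} : ∀ (l : List ℕ), (∀ a ∈ l, (a : ZMod N) ^ L = 1) → ((l.prod : ℕ) : ZMod N) ^ L = 1
  | [], _ => by simp
  | a :: l, h => by
    rw [List.prod_cons, Nat.cast_mul, mul_pow, h a (by simp), one_mul]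
    exact cast_prod_pow_eq_one l fun b hb => h b (by simp [hb])

/-- **Consequence for the torsion argument**: if every `a ∈ [2, B]` satisfies `a^L = 1` in `ℤ/N`
and `B^u < N`, then `ℤ/N` has at least `m^u` solutions of `x^L = 1` (for `u · m ≤ π(B)`). [folklore] -/
theorem le_card_pow_eq_one {N B u m L : ℕ} [NeZero N] (h : u * m ≤ Nat.primeCounting B) (hBN : B ^ u < N)
    (hall : ∀ a : ℕ, 2 ≤ a → a ≤ B → (a : ZMod N) ^ L = 1) :
    m ^ u ≤ (univ.filter fun x : ZMod N => x ^ L = 1).card := by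
  classical
  obtain ⟨S, hS, hSp⟩ := exists_many_products h
  rw [← hS]
  refine card_le_card_of_injOn (fun s : ℕ => (s : ZMod N)) (fun s hs => ?_) (fun s hs t ht hst => ?_)
  · obtain ⟨-, -, l, -, hlB, rfl⟩ := hSp s (mem_coe.1 hs)
    simp only [coe_filter, Set.mem_setOf_eq, mem_univ, true_and]
    exact cast_prod_pow_eq_one l fun a ha => hall a (hlB a ha).1 (hlB a ha).2
  · obtain ⟨hs0, hsB, -⟩ := hSp s (mem_coe.1 hs)
    obtain ⟨ht0, htB, -⟩ := hSp t (mem_coe.1 ht)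
    have := (ZMod.natCast_eq_natCast_iff' s t N).1 hst
    rw [Nat.mod_eq_of_lt (by omega), Nat.mod_eq_of_lt (by omega)] at this
    exact this

end HarveyNT


end Literature.Computability.Complexity
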